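/-
Copyright: the b2b-balaban T⁴-continuum CRUX team, row NE7b OWNER lineage `t4-ne7b-p1` (gen 124). Project licence.
-/
import Summits.QuantumFields.BalabanUV.T4Continuum.Spine.NE7b.SupZdCoarseInverseIdentities

/-!
# THE INFINITE-VOLUME RESPONSE KERNEL: on `ℤ^d`, for the road's class (`V : ℤ^d → [−λ, Λ]`, `d ≥ 3`, ANY bounded block columns `Ψ` of
# `H_V`, `M = T_∞⁻¹` of (194)∕(195)), the response to the unit coarse source at `b₀`, `h_{b₀} = Σ′_{b′}M(b′,b₀)Ψ_{b′}`, is an ABSOLUTELY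
# CONVERGENT superposition with `|h_{b₀}(p)| ≤ C·e^{−δ|blk n p − b₀|₁}`, `Q′h_{b₀} = e_{b₀}` and `H_Vh_{b₀} = M(blk n ·, b₀)` (block-constant) —
# the two displays that define the road's response operator `D = H⁻¹Q′*(Q′H⁻¹Q′*)⁻¹` ((100)∕(137)), now in infinite volume, with `(C, δ)`
# from `(d, a, λ, Λ)` ONLY (row NE7b, node U5c; (180)∕(181)∕(189)∕(194)∕(195) BY NAME; [folklore])

Cell `pub-balaban`, sub-cell `t4`, spine estimate NE7b (`T4WeightBudget.RelWeightBound`; the cell's OWN estimate — NOT PRINTED in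
[Bałaban 1983–89], NOT PROVED).  Crux-route work under `Spine/NE7b/` by the row OWNER (`t4-ne7b-p1` gen 124, file (200)) under FREEZE
(0)'s crux-prover clause; NOTHING of Bałaban's is named as a Lean object, valued or asserted; no `T4Continuum/Support` leaf typed; no `def`,
no notation (the response WRITTEN OUT as the series `Σ′_{b′}M(b′,b₀)Ψ_{b′}`; `M` ANY kernel with (194)'s cube-limit property); zero `sorry`.
Imports (BY NAME): the OWNER's (195) `…SupZdCoarseInverseIdentities` (`zd_coarse_inverse_symmetric`, `zd_coarse_mul_inverse`; through it
(194) `zd_coarse_section_inverse`, `l1_triangle`, (189) `summable_exp_l1`, `tsum_exp_l1_le`, (181) `zd_bounded_solution_unique`, (180)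
`zd_propagator_exists`), Mathlib's `Summable.tsum_finsetSum`, `Summable.tsum_mul_left`, `norm_tsum_le_tsum_norm`, `tsum_eq_single`.

WHY (located).  § [NE7bP1-G123-HANDOFF] NEXT (3)(a), second half: «then the response ∕ covariance on `ℤ^d` by name».  On the torus the
response to `e_{y₀}` is the FINITE superposition `Σ_{y′}T⁻¹(y′,y₀)ψ_{y′}` ((137)); on `ℤ^d` it is the series `Σ′_{b′}M(b′,b₀)Ψ_{b′}`, whose
terms are dominated by `c₁e^{−δ₁|b′ − b₀|₁}·C₀e^{−δ₀|blk n p − b′|₁}` ((194)'s uniform section decay passed to the cube limit; (180)+(181)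
for the block columns): a convolution of two exponentials, summable with an exponential bound (half the rate pays for the triangle
inequality, (189) sums the other half).  The block means exchange with the series and give `Σ′_{b′}T_∞(b,b′)M(b′,b₀) = δ_{bb₀}` ((195)); the
finite stencil of `H_V` passes through the series termwise (`H_VΨ_{b′} = 𝟙_{B n b′}`), leaving `M(blk n p, b₀)`.

WHAT IS PROVED ([folklore]; `X d = ℤ^d`; the `ℤ^d` operator DISPLAYED): §1 **`tsum_exp_conv_le`** (`Σ′_{b′}e^{−m|b′ − b₀|₁}e^{−m|c − b′|₁} ≤
K_{m∕2}e^{−(m∕2)|c − b₀|₁}`, summable); §2 **`zd_response_kernel`** (THE END: `∃ C δ > 0`: for ALL `n, V, Ψ`, ANY cube limit `M`, every `b₀`: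
`Summable`, (i) `|Σ′_{b′}M(b′,b₀)Ψ_{b′}(p)| ≤ Ce^{−δ|blk n p − b₀|₁}`, (ii) `(n+1)^{−d}Σ_{q ∈ B n b}h_{b₀}(q) = δ_{bb₀}`, (iii) `(H_Vh_{b₀})(p) =
M(blk n p, b₀)`).

HONEST (what this is NOT).  The response kernel only — the fluctuation covariance `C_∞ = H_∞⁻¹ − (n+1)^{−d}Σ′Ψ_bM(b,b′)Ψ_{b′}` on `ℤ^d`, the
torus → `ℤ^d` limits of response and covariance, and the `H + K` column on `ℤ^d` are the sequel; `d ≥ 3` only; the LINEAR column only;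
scalar skeleton ((A3), NC-NE7b-α UNRULED); nothing of the covariant propagators of [B4]–[B6]; nothing of Bałaban's asserted.  BY-NAME
EFFECT ON THE WALL: NONE.  NE7b NOT PRINTED ∕ NOT PROVED; spine PROVED 0∕9; rung (B)+1 — the programme's measures remain FINITE-torus
statements; NOT the mass gap, NOT Clay.  HONEST DEPENDENCY: continuum YM on T⁴ ⇐ BetaPertH ∧ nine spine estimates (0∕9 proved); BetaPertH
⇐ (D1) ∧ (D4) ∧ CAP+tail; G-an2-4 gates asym, D1 and NE2∕3∕4.
-/

set_option autoImplicit false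

noncomputable section

namespace Summit.QuantumFields.BalabanUV.T4Continuum.NE7b.SupZdResponseKernel

open Real Filter Topology
open Literature.MathematicalPhysics.QuantumFieldTheory.Balaban1983to89
open B6QGQLower276 (X e blk B side chart mem_B sum_B sum_B_const card_cube blk_chart)
open SupZdPropagatorLimit (zd_propagator_exists)
open SupZdPropagatorUniqueness (zd_bounded_solution_unique)
open SupZdExponentialSums (summable_exp_l1 tsum_exp_l1_le)
open SupZdCoarseForm (natAbs_sub_comm_sum)
open SupZdCoarseInverse (l1_triangle zd_coarse_section_inverse)
open SupZdCoarseInverseIdentities (zd_coarse_inverse_symmetric zd_coarse_inverse_decay zd_coarse_mul_inverse)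

variable {d : ℕ}

/-! ## §1. Convolution of two exponentials on `ℤ^d` -/

/-- **CONVOLUTION OF EXPONENTIALS**: `Σ′_{b′}e^{−m|b′ − b₀|₁}e^{−m|c − b′|₁} ≤ K_{m∕2}·e^{−(m∕2)|c − b₀|₁}` (`K_α = (2∕(1 − e^{−α}))^d`) — half the rate
pays for the triangle inequality, the other half is summed by (189). [folklore] -/
theorem tsum_exp_conv_le {m : ℝ} (hm : 0 < m) (b₀ c : X d) :
    Summable (fun b' : X d => exp (-(m * ∑ i, (((b' i - b₀ i).natAbs : ℕ) : ℝ))) * exp (-(m * ∑ i, (((c i - b' i).natAbs : ℕ) : ℝ)))) ∧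
    ∑' b' : X d, exp (-(m * ∑ i, (((b' i - b₀ i).natAbs : ℕ) : ℝ))) * exp (-(m * ∑ i, (((c i - b' i).natAbs : ℕ) : ℝ)))
      ≤ (2 * (1 - exp (-(m / 2)))⁻¹) ^ d * exp (-(m / 2 * ∑ i, (((c i - b₀ i).natAbs : ℕ) : ℝ))) := by
  have hm2 : 0 < m / 2 := by linarith
  have hpt : ∀ b' : X d, exp (-(m * ∑ i, (((b' i - b₀ i).natAbs : ℕ) : ℝ))) * exp (-(m * ∑ i, (((c i - b' i).natAbs : ℕ) : ℝ)))
      ≤ exp (-(m / 2 * ∑ i, (((c i - b₀ i).natAbs : ℕ) : ℝ))) * exp (-(m / 2 * ∑ i, (((c i - b' i).natAbs : ℕ) : ℝ))) := by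
    intro b'
    rw [← exp_add, ← exp_add]
    refine exp_le_exp.2 ?_
    have htri := l1_triangle c b' b₀
    have h0 : (0 : ℝ) ≤ ∑ i, (((b' i - b₀ i).natAbs : ℕ) : ℝ) := by positivity
    have h1 : (0 : ℝ) ≤ ∑ i, (((c i - b' i).natAbs : ℕ) : ℝ) := by positivity
    nlinarith
  have hs2 : Summable fun b' : X d => exp (-(m / 2 * ∑ i, (((c i - b₀ i).natAbs : ℕ) : ℝ)))
      * exp (-(m / 2 * ∑ i, (((c i - b' i).natAbs : ℕ) : ℝ))) := (summable_exp_l1 hm2 c).mul_left _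
  have hs1 : Summable fun b' : X d => exp (-(m * ∑ i, (((b' i - b₀ i).natAbs : ℕ) : ℝ)))
      * exp (-(m * ∑ i, (((c i - b' i).natAbs : ℕ) : ℝ))) :=
    Summable.of_nonneg_of_le (fun b' => by positivity) hpt hs2
  refine ⟨hs1, (hs1.tsum_le_tsum hpt hs2).trans ?_⟩
  rw [(summable_exp_l1 hm2 c).tsum_mul_left, mul_comm]
  exact mul_le_mul_of_nonneg_right (tsum_exp_l1_le hm2 c) (exp_pos _).le

/-! ## §2. THE END: the infinite-volume response kernel `h_{b₀} = Σ′_{b′}M(b′,b₀)Ψ_{b′}` -/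

/-- **HEADLINE — THE INFINITE-VOLUME RESPONSE TO A UNIT COARSE SOURCE**: `d ≥ 3`, `a > 0`, `λ < min(2,a)`, `Λ ≥ 0` ⟹ `∃ C δ > 0` (from
`(d, a, λ, Λ)` ONLY) such that for ALL `n`, `V : ℤ^d → [−λ, Λ]`, ANY bounded block columns `Ψ` of `H_V` on `ℤ^d`, ANY kernel `M` with (194)'s
cube-limit property (= `T_∞⁻¹`, (195)) and every coarse `b₀`: the series `h_{b₀}(p) = Σ′_{b′}M(b′,b₀)Ψ_{b′}(p)` converges absolutely,
(i) `|h_{b₀}(p)| ≤ C·e^{−δ|blk n p − b₀|₁}`; (ii) `Q′h_{b₀} = e_{b₀}` (`(n+1)^{−d}Σ_{B n b}h_{b₀} = δ_{bb₀}` — (195) `T_∞M = 1`); (iii)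
`H_Vh_{b₀} = M(blk n ·, b₀)` (block-constant: the finite stencil through the series) — the two displays that DEFINE the road's response
`D e_{b₀}` ((100)∕(137)), now on `ℤ^d`; `h_{b₀}` is THE bounded solution of (iii) ((181)). [folklore] -/
theorem zd_response_kernel (hd : 3 ≤ d) (a : ℝ) (ha : 0 < a) {lam Lam : ℝ} (hlam : lam < min 2 a) (hLam : 0 ≤ Lam) :
    ∃ C δ : ℝ, 0 < C ∧ 0 < δ ∧ ∀ (n : ℕ) (V : X d → ℝ), (∀ p, -lam ≤ V p) → (∀ p, V p ≤ Lam) →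
      ∀ (Ψ : X d → X d → ℝ) (BΨ : X d → ℝ), (∀ b' p, |Ψ b' p| ≤ BΨ b') →
      (∀ b' p, ((n : ℝ) + 1) ^ 2 * ∑ μ, (2 * Ψ b' p - Ψ b' (p + e μ) - Ψ b' (p - e μ))
        + a / ((n : ℝ) + 1) ^ d * ∑ q ∈ B n (blk n p), Ψ b' q + V p * Ψ b' p = if blk n p = b' then 1 else 0) →
      ∀ (M : X d → X d → ℝ), (∀ b b' : X d, Tendsto (fun R : ℕ =>
          if h : b ∈ (Fintype.piFinset fun _ : Fin d => Finset.Icc (-(R : ℤ)) R) ∧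
              b' ∈ (Fintype.piFinset fun _ : Fin d => Finset.Icc (-(R : ℤ)) R)
            then (Matrix.of fun c c' : ↥(Fintype.piFinset fun _ : Fin d => Finset.Icc (-(R : ℤ)) R) =>
              (((n : ℝ) + 1) ^ d)⁻¹ * ∑ q ∈ B n (c : X d), Ψ (c' : X d) q)⁻¹ ⟨b, h.1⟩ ⟨b', h.2⟩ else 0)
        atTop (𝓝 (M b b'))) →
      ∀ b₀ : X d,
        (∀ p, Summable fun b' : X d => M b' b₀ * Ψ b' p) ∧
        (∀ p, |∑' b' : X d, M b' b₀ * Ψ b' p| ≤ C * exp (-(δ * ∑ i, (((blk n p i - b₀ i).natAbs : ℕ) : ℝ)))) ∧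
        (∀ b, (((n : ℝ) + 1) ^ d)⁻¹ * ∑ q ∈ B n b, (∑' b' : X d, M b' b₀ * Ψ b' q) = if b = b₀ then 1 else 0) ∧
        (∀ p, ((n : ℝ) + 1) ^ 2 * ∑ μ, (2 * (∑' b' : X d, M b' b₀ * Ψ b' p) - (∑' b' : X d, M b' b₀ * Ψ b' (p + e μ))
            - (∑' b' : X d, M b' b₀ * Ψ b' (p - e μ)))
          + a / ((n : ℝ) + 1) ^ d * ∑ q ∈ B n (blk n p), (∑' b' : X d, M b' b₀ * Ψ b' q) + V p * (∑' b' : X d, M b' b₀ * Ψ b' p)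
          = M (blk n p) b₀) := by
  classical
  obtain ⟨C₀, δ₀, hC₀, hδ₀, H180⟩ := zd_propagator_exists (d := d) hd a ha hlam hLam
  -- the decay of `M` with (194)'s section constants (chosen before `n, V, Ψ, M`)
  obtain ⟨c₁, δ₁, hc₁, hδ₁, H4⟩ := zd_coarse_section_inverse (d := d) hd a ha hlam hLam
  set m : ℝ := min δ₀ δ₁ with hm
  have hm0 : 0 < m := lt_min hδ₀ hδ₁
  have hmδ₀ : m ≤ δ₀ := min_le_left _ _
  have hmδ₁ : m ≤ δ₁ := min_le_right _ _
  set K : ℝ := (2 * (1 - exp (-(m / 2)))⁻¹) ^ d with hK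
  have hK0 : 0 < K := pow_pos (mul_pos two_pos (inv_pos.2 (sub_pos.2 (exp_lt_one_iff.2 (by linarith))))) d
  refine ⟨c₁ * C₀ * K, m / 2, by positivity, by positivity, ?_⟩
  intro n V hV hV' Ψ BΨ hΨB hΨ M hM b₀
  -- decay of the block columns ((180) + (181))
  have hΨd : ∀ b' p, |Ψ b' p| ≤ C₀ * exp (-(δ₀ * ∑ i, (((blk n p i - b' i).natAbs : ℕ) : ℝ))) := by
    intro b' p
    obtain ⟨v, hveq, hvdec⟩ := H180 n V hV hV' b' 1 (fun p => if blk n p = b' then (1 : ℝ) else 0)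
      (fun p hp => by rw [if_neg hp]) (fun p => by split_ifs <;> simp)
    have hvB : ∀ p, |v p| ≤ C₀ * 1 := fun p =>
      (le_mul_of_one_le_left (abs_nonneg _) (one_le_exp (by positivity))).trans (hvdec p)
    have hΨv : Ψ b' = v := zd_bounded_solution_unique hd a ha hlam hLam n V hV hV' _ (Ψ b') v (hΨB b') hvB (hΨ b') hveq
    have h := hvdec p
    rw [← hΨv, mul_one] at h
    have hE := exp_pos (δ₀ * ∑ i, (((blk n p i - b' i).natAbs : ℕ) : ℝ))
    rw [exp_neg, ← div_eq_mul_inv, le_div_iff₀ hE, mul_comm]; exact h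
  -- decay of `M` (the cube limit of the uniformly decaying section inverses) and its symmetry ((195))
  have hMd : ∀ b b', |M b b'| ≤ c₁ * exp (-(δ₁ * ∑ i, (((b i - b' i).natAbs : ℕ) : ℝ))) := fun b b' => by
    refine le_of_tendsto' (hM b b').abs fun R => ?_
    split_ifs with h
    · exact (H4 n V hV hV' Ψ BΨ hΨB hΨ _ _ (Finset.Subset.refl _)).1 ⟨b, h.1⟩ ⟨b', h.2⟩
    · rw [abs_zero]; positivity
  have hMs : ∀ b b', M b b' = M b' b := zd_coarse_inverse_symmetric hd a ha hlam hLam n V hV hV' Ψ BΨ hΨB hΨ M hM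
  -- termwise domination by a convolution of two exponentials of rate `m`
  have hdom : ∀ p b', |M b' b₀ * Ψ b' p| ≤ c₁ * C₀ * (exp (-(m * ∑ i, (((b' i - b₀ i).natAbs : ℕ) : ℝ)))
      * exp (-(m * ∑ i, (((blk n p i - b' i).natAbs : ℕ) : ℝ)))) := by
    intro p b'
    rw [abs_mul]
    have e1 := hMd b' b₀
    have e2 := hΨd b' p
    have e3 : c₁ * exp (-(δ₁ * ∑ i, (((b' i - b₀ i).natAbs : ℕ) : ℝ))) ≤ c₁ * exp (-(m * ∑ i, (((b' i - b₀ i).natAbs : ℕ) : ℝ))) :=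
      mul_le_mul_of_nonneg_left (exp_le_exp.2 (by nlinarith [show (0:ℝ) ≤ ∑ i, (((b' i - b₀ i).natAbs : ℕ) : ℝ) by positivity])) hc₁.le
    have e4 : C₀ * exp (-(δ₀ * ∑ i, (((blk n p i - b' i).natAbs : ℕ) : ℝ)))
        ≤ C₀ * exp (-(m * ∑ i, (((blk n p i - b' i).natAbs : ℕ) : ℝ))) :=
      mul_le_mul_of_nonneg_left (exp_le_exp.2 (by nlinarith [show (0:ℝ) ≤ ∑ i, (((blk n p i - b' i).natAbs : ℕ) : ℝ) by positivity])) hC₀.le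
    calc |M b' b₀| * |Ψ b' p| ≤ (c₁ * exp (-(m * ∑ i, (((b' i - b₀ i).natAbs : ℕ) : ℝ))))
          * (C₀ * exp (-(m * ∑ i, (((blk n p i - b' i).natAbs : ℕ) : ℝ)))) :=
          mul_le_mul (e1.trans e3) (e2.trans e4) (abs_nonneg _) (by positivity)
      _ = _ := by ring
  have hs : ∀ p, Summable fun b' : X d => M b' b₀ * Ψ b' p := fun p =>
    Summable.of_norm_bounded (((tsum_exp_conv_le hm0 b₀ (blk n p)).1).mul_left (c₁ * C₀)) fun b' => by
      rw [Real.norm_eq_abs]; exact hdom p b'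
  have hbd : ∀ p, |∑' b' : X d, M b' b₀ * Ψ b' p| ≤ c₁ * C₀ * K * exp (-(m / 2 * ∑ i, (((blk n p i - b₀ i).natAbs : ℕ) : ℝ))) := by
    intro p
    obtain ⟨hcs, hcb⟩ := tsum_exp_conv_le hm0 b₀ (blk n p)
    have h1 : |∑' b' : X d, M b' b₀ * Ψ b' p| ≤ ∑' b' : X d, |M b' b₀ * Ψ b' p| := by
      have := norm_tsum_le_tsum_norm (hs p).norm
      simpa only [Real.norm_eq_abs] using this
    have h2 := (hs p).abs.tsum_le_tsum (hdom p) (hcs.mul_left (c₁ * C₀))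
    rw [Summable.tsum_mul_left _ hcs] at h2
    have h3 := mul_le_mul_of_nonneg_left hcb (show 0 ≤ c₁ * C₀ by positivity)
    calc |∑' b' : X d, M b' b₀ * Ψ b' p| ≤ c₁ * C₀ * ((2 * (1 - exp (-(m / 2)))⁻¹) ^ d
          * exp (-(m / 2 * ∑ i, (((blk n p i - b₀ i).natAbs : ℕ) : ℝ)))) := h1.trans (h2.trans h3)
      _ = _ := by rw [hK]; ring
  refine ⟨hs, hbd, fun b => ?_, fun p => ?_⟩
  · -- block means: `(n+1)^{−d}Σ_{B n b}Σ′_{b′}M(b′,b₀)Ψ_{b′} = Σ′_{b′}T_∞(b,b′)M(b′,b₀) = δ_{bb₀}`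
    have hTM := (zd_coarse_mul_inverse hd a ha hlam hLam n V hV hV' Ψ BΨ hΨB hΨ M hM b b₀).2
    rw [← Summable.tsum_finsetSum (fun q _ => hs q), ← Summable.tsum_mul_left _ (summable_sum fun q _ => hs q), ← hTM]
    refine tsum_congr fun b' => ?_
    rw [Finset.mul_sum, Finset.mul_sum, Finset.sum_mul]
    exact Finset.sum_congr rfl fun q _ => by ring
  · -- the equation: termwise `H_V(M(b′,b₀)Ψ_{b′})(p) = M(b′,b₀)𝟙[blk n p = b′]`, summed over `b′`
    have hpt : ∑' b' : X d, (((n : ℝ) + 1) ^ 2 * ∑ μ, (2 * (M b' b₀ * Ψ b' p) - M b' b₀ * Ψ b' (p + e μ) - M b' b₀ * Ψ b' (p - e μ))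
        + a / ((n : ℝ) + 1) ^ d * ∑ q ∈ B n (blk n p), M b' b₀ * Ψ b' q + V p * (M b' b₀ * Ψ b' p)) = M (blk n p) b₀ := by
      have e1 : ∀ b', ((n : ℝ) + 1) ^ 2 * ∑ μ, (2 * (M b' b₀ * Ψ b' p) - M b' b₀ * Ψ b' (p + e μ) - M b' b₀ * Ψ b' (p - e μ))
          + a / ((n : ℝ) + 1) ^ d * ∑ q ∈ B n (blk n p), M b' b₀ * Ψ b' q + V p * (M b' b₀ * Ψ b' p)
          = M b' b₀ * (if blk n p = b' then 1 else 0) := by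
        intro b'
        rw [← hΨ b' p, ← Finset.mul_sum]
        have e2 : ∑ μ, (2 * (M b' b₀ * Ψ b' p) - M b' b₀ * Ψ b' (p + e μ) - M b' b₀ * Ψ b' (p - e μ))
            = M b' b₀ * ∑ μ, (2 * Ψ b' p - Ψ b' (p + e μ) - Ψ b' (p - e μ)) := by
          rw [Finset.mul_sum]; exact Finset.sum_congr rfl fun μ _ => by ring
        rw [e2]; ring
      simp only [e1]
      rw [tsum_eq_single (blk n p) (fun b' hb' => by rw [if_neg (Ne.symm hb'), mul_zero]), if_pos rfl, mul_one]
    have hS1 : ∀ μ : Fin d, Summable fun b' : X d => 2 * (M b' b₀ * Ψ b' p) - M b' b₀ * Ψ b' (p + e μ) - M b' b₀ * Ψ b' (p - e μ) :=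
      fun μ => (((hs p).mul_left 2).sub (hs (p + e μ))).sub (hs (p - e μ))
    have hS1s : Summable fun b' : X d => ∑ μ, (2 * (M b' b₀ * Ψ b' p) - M b' b₀ * Ψ b' (p + e μ) - M b' b₀ * Ψ b' (p - e μ)) :=
      summable_sum fun μ _ => hS1 μ
    have hS2 : Summable fun b' : X d => ∑ q ∈ B n (blk n p), M b' b₀ * Ψ b' q := summable_sum fun q _ => hs q
    have hT1 : ∑' b' : X d, ∑ μ, (2 * (M b' b₀ * Ψ b' p) - M b' b₀ * Ψ b' (p + e μ) - M b' b₀ * Ψ b' (p - e μ))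
        = ∑ μ, (2 * (∑' b' : X d, M b' b₀ * Ψ b' p) - (∑' b' : X d, M b' b₀ * Ψ b' (p + e μ))
          - (∑' b' : X d, M b' b₀ * Ψ b' (p - e μ))) := by
      rw [Summable.tsum_finsetSum fun μ _ => hS1 μ]
      refine Finset.sum_congr rfl fun μ _ => ?_
      rw [(((hs p).mul_left 2).sub (hs (p + e μ))).tsum_sub (hs (p - e μ)), ((hs p).mul_left 2).tsum_sub (hs (p + e μ)),
        (hs p).tsum_mul_left 2]
    have hT2 : ∑' b' : X d, ∑ q ∈ B n (blk n p), M b' b₀ * Ψ b' q = ∑ q ∈ B n (blk n p), ∑' b' : X d, M b' b₀ * Ψ b' q :=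
      Summable.tsum_finsetSum fun q _ => hs q
    have hmain : ∑' b' : X d, (((n : ℝ) + 1) ^ 2 * ∑ μ, (2 * (M b' b₀ * Ψ b' p) - M b' b₀ * Ψ b' (p + e μ) - M b' b₀ * Ψ b' (p - e μ))
        + a / ((n : ℝ) + 1) ^ d * ∑ q ∈ B n (blk n p), M b' b₀ * Ψ b' q + V p * (M b' b₀ * Ψ b' p))
        = ((n : ℝ) + 1) ^ 2 * ∑' b' : X d, ∑ μ, (2 * (M b' b₀ * Ψ b' p) - M b' b₀ * Ψ b' (p + e μ) - M b' b₀ * Ψ b' (p - e μ))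
          + a / ((n : ℝ) + 1) ^ d * ∑' b' : X d, ∑ q ∈ B n (blk n p), M b' b₀ * Ψ b' q
          + V p * ∑' b' : X d, M b' b₀ * Ψ b' p := by
      rw [Summable.tsum_add ((hS1s.mul_left _).add (hS2.mul_left _)) ((hs p).mul_left _),
        Summable.tsum_add (hS1s.mul_left _) (hS2.mul_left _), hS1s.tsum_mul_left (((n : ℝ) + 1) ^ 2),
        hS2.tsum_mul_left (a / ((n : ℝ) + 1) ^ d), (hs p).tsum_mul_left (V p)]
    rw [← hpt, hmain, hT1, hT2]

/-! ## §3. Toy -/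

/-- Toy (`d = 3`, `m = 1`): the convolution of two unit-rate exponentials around the origin of `ℤ³` is summable. -/
example : Summable (fun b' : X 3 => exp (-(1 * ∑ i, (((b' i - (0 : X 3) i).natAbs : ℕ) : ℝ)))
    * exp (-(1 * ∑ i, ((((0 : X 3) i - b' i).natAbs : ℕ) : ℝ)))) := (tsum_exp_conv_le (d := 3) one_pos 0 0).1

end Summit.QuantumFields.BalabanUV.T4Continuum.NE7b.SupZdResponseKernel
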